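import Summits.HubbardSuperconductivity.HubbardSuperconductivity.Theorems.AnisotropyChordTransferFibre3KT2bRow
import Summits.HubbardSuperconductivity.HubbardSuperconductivity.Theorems.AnisotropyChordTransferFibre3C0Shell
import Summits.HubbardSuperconductivity.HubbardSuperconductivity.Theorems.AnisotropyChordTransferFibre3NC0Split

/-!
# Route `AnisotropyChord` / H0 rotor rung: PartN41-C §4 targets PROVED — `NC0Split`, `C0ShellForm` (`L ≥ 3`)

The typed targets of the ported KT-2b row file `…Fibre3KT2bRow` (theory-1 g22 PartN41C, sha16 d3b59d8f014e40ce):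
★ `nC0Split_holds (Δ) : NC0Split L Δ` (…NC0Split) and ★ `c0ShellForm_holds (hL : 3 ≤ L) (Δ) : C0ShellForm L Δ` (…C0Shell;
the neighbour vectors must be distinct, hence `L ≥ 3` — the row is used at `L ≥ 128`).
Prover seat `hubbard-h0-rotor-p1` g26 (route lead); helper for stmt-HubbardSuperconductivity-23918 (`--supports`, helper class).
WHAT THIS IS NOT: nothing here proves superconductivity in the Hubbard model.  Tree imports only; no new definitions; no sorry.
-/

set_option linter.dupNamespace false
set_option autoImplicit false

noncomputable section

namespace Summit.HubbardSuperconductivity.HubbardSuperconductivity.Theorems.AnisotropyChord.Transfer.Fibre3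

variable (L : ℕ) [NeZero L]

/-- ★ `NC0Split L Δ` holds. [folklore] -/
theorem nC0Split_holds (Δ : ℝ) : NC0Split L Δ := by
  intro lam2 f hf
  refine ⟨?_, ShellRow.nC0p_le_nC0 L hf⟩
  unfold nC0shell
  convert ShellRow.nC0_split L Δ lam2 f using 3

/-- ★ `C0ShellForm L Δ` holds for `L ≥ 3`. [folklore] -/
theorem c0ShellForm_holds (hL : 3 ≤ L) (Δ : ℝ) : C0ShellForm L Δ :=
  fun _lam2 _f hf b hb0 hb1 => ShellRow.c0_shell_form L hL hf b hb0 hb1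

end Summit.HubbardSuperconductivity.HubbardSuperconductivity.Theorems.AnisotropyChord.Transfer.Fibre3

end
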